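import Summits.HodgeConjecture.HodgeConjecture.Theorems.TropicalKugaSatakeCayleyFormalCycleCriterionCycleClassLemmas
import Summits.HodgeConjecture.HodgeConjecture.Theorems.EffectiveCayleyNonRealizability.Negative.PointwiseFalse
import HarnessLib

/-!
# Crux `FormalCycleCriterion` (stmt-HodgeConjecture-18571), line `birth` — registered stub 3
# `stub_cycleClassRational`, PROVED: period classes of tropical cycles are rational

Route `TropicalKugaSatakeCayley` of `HodgeConjecture`. Stub 3 of the registered skeleton
`Cruxes/FormalCycleCriterion/Lines/birth.lean` (the crux's "first named risk", homology invariance of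
the tautological class for the framed-chain encoding of `Tropical/TropicalTorusWeilCycles`): for a
positive definite period matrix `P` and a framed simplicial `2`-chain `Z` of `ℝ⁸` with `Z.IsCycle P`,
the period class `compound 2 P⁻¹ · Z.classOf` is a RATIONAL matrix.

Proof (for every `g`, `cycleClassRational`; the stub is `g = 8`). Write `Q = P⁻¹`, `u = Q v` for
the vertices of the cells, and fix an entry `(K, J)`.
1. ENTRY FORMULA (`compound_mul_classOf_apply`, Cauchy–Binet for `2 × 2` minors): the entry is
   `Σ_c ½ framing_c(J) · B(u_c1 − u_c0, u_c2 − u_c0)` with `B` the `K`-th `2 × 2` wedge; summing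
   over the six ordered faces `(i, π)` of each triangle it is `¼ Σ_t μ_t B(x_t, y_t)`, `t = (c, i, π)`,
   `(x_t, y_t)` the `Q`-image of the ordered face, `μ_t = sign π (−1)^i framing_c(J)`.
2. THE CYCLE CONDITION read through `Q` (`sum_filter_faceIndex_eq_zero`): every `ℤ^g`-translation
   class of pairs `(x_t, y_t)` has `Σ μ_t = 0`; START-VERTEX CANCELLATION
   (`sum_faceIndex_startVertex_eq_zero`): `Σ_t μ_t F(x_t) = 0` for every `F`; FACE REVERSAL
   `π ↦ π ∘ swap` exchanges `x_t, y_t` and negates `μ_t`.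
3. DISCRETE STOKES (`sum_bilin_eq_sum_bilin_intPart`, the lemmas file): under 2., replacing every
   point by its integer part `ℓ` (w.r.t. fixed representatives of `ℝ^g / ℤ^g`) does not change
   `Σ_t μ_t B(x_t, y_t)`. Undoing 1. for the integer vertices gives
   `Σ_c ½ framing_c(J) · B(ℓu_c1 − ℓu_c0, ℓu_c2 − ℓu_c0) ∈ ℚ`.

No named fact, no new definition, no sorry. The last theorem has the REGISTERED SIGNATURE VERBATIM.

References: [MikhalkinZharkov2014Eigenwave] G. Mikhalkin, I. Zharkov, Tropical eigenwave and
intermediate Jacobians, LN UMI 15 (2014), Def. 4.2, Prop. 4.3, Thm. 5.4; [Zharkov2020TropicalWeil]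
I. Zharkov, Tropical abelian varieties, Weil classes and the Hodge conjecture, arXiv:2002.02347, p. 2.
-/

noncomputable section

-- `Summit.HodgeConjecture.HodgeConjecture.…` is the mandated namespace (single-conjunct summit).
set_option linter.dupNamespace false

open scoped BigOperators

namespace Summit.HodgeConjecture.HodgeConjecture.Theorems.FormalCycleCriterion

open Literature.AlgebraicGeometry.Tropical
open Literature.AlgebraicGeometry.Tropical.TropicalTorus
-- two small helpers (`∑` over `Perm (Fin 2)`, `sign (swap 0 1) = -1`) from the sibling crux's Negative file
open Summit.HodgeConjecture.HodgeConjecture.Theorems.EffectiveCayleyNonRealizability.Negative.PointwiseFalse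
  (sum_perm_fin_two sign_swap01)

section Triangle

variable {V : Type*} [AddCommGroup V] [Module ℝ V]

/-- The values of `Fin.succAbove` on `Fin 3 × Fin 2` (which vertices the ordered faces of a
triangle consist of). [folklore] -/
theorem succAbove_fin_three :
    (0 : Fin 3).succAbove (0 : Fin 2) = 1 ∧ (0 : Fin 3).succAbove (1 : Fin 2) = 2 ∧
    (1 : Fin 3).succAbove (0 : Fin 2) = 0 ∧ (1 : Fin 3).succAbove (1 : Fin 2) = 2 ∧
    (2 : Fin 3).succAbove (0 : Fin 2) = 0 ∧ (2 : Fin 3).succAbove (1 : Fin 2) = 1 := by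
  decide

/-- **Start-vertex cancellation**: over the six ordered faces `(i, π)` of a triangle, the signed
values of any function of the FIRST vertex cancel. [folklore] -/
theorem sum_sign_startVertex_eq_zero {W M : Type*} [AddCommGroup M] [Module ℝ M]
    (u : Fin 3 → W) (F : W → M) :
    ∑ i : Fin 3, ∑ π : Equiv.Perm (Fin 2),
      (((Equiv.Perm.sign π : ℤˣ) : ℤ) * (-1) ^ (i : ℕ) : ℝ) • F (u (i.succAbove (π 0))) = 0 := by
  obtain ⟨h00, h01, h10, h11, h20, h21⟩ := succAbove_fin_three
  simp only [Fin.sum_univ_three, sum_perm_fin_two, Equiv.Perm.sign_one, Units.val_one,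
    sign_swap01, Equiv.Perm.one_apply, Equiv.swap_apply_left, h00, h01, h10, h11, h20, h21,
    Fin.val_zero, Fin.val_one, Fin.val_two, pow_zero, pow_one, Int.cast_one, Int.cast_neg]
  norm_num
  abel

/-- **The ordered faces recover twice the wedge of the edges**: for an antisymmetric bilinear `B`,
`Σ_{i,π} sign π (-1)^i B(u_{face 0}, u_{face 1}) = 2 B(u₁ - u₀, u₂ - u₀)`. [folklore] -/
theorem sum_sign_bilin_faces (B : LinearMap.BilinForm ℝ V) (hB : ∀ a b, B a b = -B b a)
    (u : Fin 3 → V) :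
    ∑ i : Fin 3, ∑ π : Equiv.Perm (Fin 2),
      (((Equiv.Perm.sign π : ℤˣ) : ℤ) * (-1) ^ (i : ℕ) : ℝ) *
        B (u (i.succAbove (π 0))) (u (i.succAbove (π 1))) =
      2 * B (u 1 - u 0) (u 2 - u 0) := by
  obtain ⟨h00, h01, h10, h11, h20, h21⟩ := succAbove_fin_three
  simp only [Fin.sum_univ_three, sum_perm_fin_two, Equiv.Perm.sign_one, Units.val_one,
    sign_swap01, Equiv.Perm.one_apply, Equiv.swap_apply_left, Equiv.swap_apply_right,
    h00, h01, h10, h11, h20, h21,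
    Fin.val_zero, Fin.val_one, Fin.val_two, pow_zero, pow_one, Int.cast_one, Int.cast_neg,
    map_sub, LinearMap.sub_apply]
  have h00' : B (u 0) (u 0) = 0 := by have := hB (u 0) (u 0); linarith
  rw [hB (u 2) (u 1), hB (u 2) (u 0), hB (u 1) (u 0), h00']
  ring

end Triangle

section Entries

variable {g : ℕ}

/-- Plücker coordinates commute with ring maps (a Plücker coordinate is a determinant). [folklore] -/
theorem pluecker_map (D : Matrix (Fin g) (Fin 2) ℚ) (K : Sub g 2) :
    pluecker (D.map (algebraMap ℚ ℝ)) K = algebraMap ℚ ℝ (pluecker D K) := by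
  rw [pluecker_two, pluecker_two]
  simp only [Matrix.map_apply, map_sub, map_mul]

/-- Plücker coordinates of a frame times a `2 × 2` matrix: `pluecker (M · B) = pluecker M · det B`.
[folklore] -/
theorem pluecker_mul_two {S : Type*} [CommRing S] (M : Matrix (Fin g) (Fin 2) S)
    (B : Matrix (Fin 2) (Fin 2) S) (K : Sub g 2) : pluecker (M * B) K = pluecker M K * B.det := by
  unfold pluecker
  rw [← Matrix.det_mul]
  congr 1

/-- The class of a framed `2`-cell at `(I, J)` is `½ · framing J · pluecker E I` with `E` the edge
matrix `dir · coefᵀ` (columns = the two edges). [folklore] -/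
theorem cell_classOf_eq (c : Cell ℝ g 2) (I J : Sub g 2) :
    c.classOf I J = (1 / 2 : ℝ) * (c.framing J : ℝ) *
      pluecker (c.dir.map (algebraMap ℚ ℝ) * c.coef.transpose) I := by
  rw [pluecker_mul_two, pluecker_map, Matrix.det_transpose]
  simp only [Cell.classOf, Matrix.of_apply, Nat.factorial, Nat.succ_eq_add_one, Nat.reduceAdd,
    Nat.reduceMul, Nat.cast_ofNat, map_mul, map_inv₀, eq_ratCast, Rat.cast_ofNat]
  ring

/-- The columns of the edge matrix are the edges. [folklore] -/
theorem edgeMatrix_col (c : Cell ℝ g 2) (i : Fin 2) :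
    (fun r => (c.dir.map (algebraMap ℚ ℝ) * c.coef.transpose) r i) = c.edge i := by
  funext r
  simp only [Matrix.mul_apply, Matrix.map_apply, Matrix.transpose_apply, Cell.edge]

/-- The edges are differences of vertices: `edge i = vertex (i+1) - vertex 0`. [folklore] -/
theorem edge_eq_vertex_sub (c : Cell ℝ g 2) (i : Fin 2) :
    c.edge i = c.vertex i.succ - c.vertex 0 := by
  simp only [Cell.vertex, Fin.cases_succ, Fin.cases_zero]
  abel

/-- The `K`-th Plücker coordinate of `Q · E` is the `(k₀, k₁)`-wedge of `Q e₀` and `Q e₁`.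
[folklore] -/
theorem pluecker_mul_eq_wedge (Q : Matrix (Fin g) (Fin g) ℝ) (E : Matrix (Fin g) (Fin 2) ℝ)
    (K : Sub g 2) :
    pluecker (Q * E) K =
      Q.mulVec (fun r => E r 0) (K.1.orderEmbOfFin K.2 0) *
          Q.mulVec (fun r => E r 1) (K.1.orderEmbOfFin K.2 1) -
        Q.mulVec (fun r => E r 0) (K.1.orderEmbOfFin K.2 1) *
          Q.mulVec (fun r => E r 1) (K.1.orderEmbOfFin K.2 0) := by
  rw [pluecker_two]
  simp only [Matrix.mul_apply, Matrix.mulVec, dotProduct]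
  ring

/-- **Entry formula for the period class.** For any `Q` and any framed `2`-chain `Z`,
`(compound 2 Q · Z.classOf)_{K,J} = Σ_c ½ · framing_c J · wedge_K (Q e₀(c), Q e₁(c))` with
`e₀ = v₁ - v₀`, `e₁ = v₂ - v₀` the edges of the cell `c` (Cauchy–Binet for `2 × 2` minors).
[cite: MikhalkinZharkov2014Eigenwave, Prop. 4.3] -/
theorem compound_mul_classOf_apply (Q : Matrix (Fin g) (Fin g) ℝ) (Z : Chain ℝ g 2)
    (K J : Sub g 2) :
    (compound 2 Q * Z.classOf) K J =
      ∑ c : Fin Z.size, (1 / 2 : ℝ) * ((Z.cell c).framing J : ℝ) *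
        (Q.mulVec ((Z.cell c).vertex 1 - (Z.cell c).vertex 0) (K.1.orderEmbOfFin K.2 0) *
            Q.mulVec ((Z.cell c).vertex 2 - (Z.cell c).vertex 0) (K.1.orderEmbOfFin K.2 1) -
          Q.mulVec ((Z.cell c).vertex 1 - (Z.cell c).vertex 0) (K.1.orderEmbOfFin K.2 1) *
            Q.mulVec ((Z.cell c).vertex 2 - (Z.cell c).vertex 0) (K.1.orderEmbOfFin K.2 0)) := by
  rw [Matrix.mul_apply]
  simp only [compound, Matrix.of_apply, Chain.classOf, Matrix.sum_apply, Finset.mul_sum]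
  rw [Finset.sum_comm]
  refine Finset.sum_congr rfl fun c _ => ?_
  have h : ∀ I, minor Q K I * (Z.cell c).classOf I J = ((1 / 2 : ℝ) * ((Z.cell c).framing J : ℝ)) *
      (minor Q K I * pluecker ((Z.cell c).dir.map (algebraMap ℚ ℝ) * (Z.cell c).coef.transpose) I) := by
    intro I
    rw [cell_classOf_eq]
    ring
  simp_rw [h]
  rw [← Finset.mul_sum, sum_minor_mul_pluecker, pluecker_mul_eq_wedge, edgeMatrix_col, edgeMatrix_col,
    edge_eq_vertex_sub, edge_eq_vertex_sub]
  rfl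

end Entries

/-! ### From the chain to the abstract discrete Stokes setting -/

section Transfer

variable {g : ℕ}

/-- **Period translates become integer translates after `P⁻¹`.** For `Q P = P Q = 1`, an ordered
pair `τ'` is a `P ℤ^g`-translate of `τ` iff `Q τ'` is a `ℤ^g`-translate of `Q τ`, vertex by vertex.
[folklore] -/
theorem isTranslate_iff_exists_int {P Q : Matrix (Fin g) (Fin g) ℝ} (hQP : Q * P = 1)
    (hPQ : P * Q = 1) (τ τ' : Fin 2 → Fin g → ℝ) :
    IsTranslate P τ τ' ↔ ∃ k : Fin g → ℤ,
      Q.mulVec (τ' 0) = Q.mulVec (τ 0) + (fun r => (k r : ℝ)) ∧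
        Q.mulVec (τ' 1) = Q.mulVec (τ 1) + (fun r => (k r : ℝ)) := by
  constructor
  · rintro ⟨k, hk⟩
    refine ⟨k, ?_, ?_⟩ <;>
      rw [hk, Matrix.mulVec_add, Matrix.mulVec_mulVec, hQP, Matrix.one_mulVec]
  · rintro ⟨k, h0, h1⟩
    refine ⟨k, fun j => ?_⟩
    have key : ∀ j, Q.mulVec (τ' j) = Q.mulVec (τ j) + (fun r => (k r : ℝ)) →
        τ' j = τ j + P.mulVec (fun r => (k r : ℝ)) := by
      intro j hj
      have h := congrArg P.mulVec hj
      rw [Matrix.mulVec_add, Matrix.mulVec_mulVec, Matrix.mulVec_mulVec, hPQ, Matrix.one_mulVec,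
        Matrix.one_mulVec] at h
      exact h
    fin_cases j
    · exact key 0 h0
    · exact key 1 h1

/-- Regrouping a sum over the face indices `(c, i, π)` by cells. [folklore] -/
theorem sum_faceIndex_eq {M : Type*} [AddCommMonoid M] [Module ℝ M] (n : ℕ) (f : Fin n → ℝ)
    (G : Fin n → Fin 3 → Equiv.Perm (Fin 2) → M) :
    ∑ t : Fin n × Fin 3 × Equiv.Perm (Fin 2),
        ((((Equiv.Perm.sign t.2.2 : ℤˣ) : ℤ) * (-1) ^ (t.2.1 : ℕ) : ℝ) * f t.1) • G t.1 t.2.1 t.2.2 =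
      ∑ c, f c • ∑ i : Fin 3, ∑ π : Equiv.Perm (Fin 2),
        (((Equiv.Perm.sign π : ℤˣ) : ℤ) * (-1) ^ (i : ℕ) : ℝ) • G c i π := by
  simp only [Fintype.sum_prod_type, Finset.smul_sum, smul_smul]
  refine Finset.sum_congr rfl fun c _ => Finset.sum_congr rfl fun i _ =>
    Finset.sum_congr rfl fun π _ => ?_
  rw [mul_comm]

/-- **Quarter-sum formula**: for an antisymmetric bilinear `B`, weights `f_c` and vertex triples
`w_c`, `Σ_c ½ f_c B(w_c1 − w_c0, w_c2 − w_c0) = ¼ Σ_{(c,i,π)} sign π (−1)^i f_c B(x, y)` where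
`(x, y)` runs over the six ordered faces of each triangle. [folklore] -/
theorem half_sum_bilin_eq_quarter_sum_faces {V : Type*} [AddCommGroup V] [Module ℝ V]
    (B : LinearMap.BilinForm ℝ V) (hB : ∀ a b, B a b = -B b a) (n : ℕ) (f : Fin n → ℝ)
    (w : Fin n → Fin 3 → V) :
    ∑ c, (1 / 2 : ℝ) * f c * B (w c 1 - w c 0) (w c 2 - w c 0) =
      (1 / 4 : ℝ) * ∑ t : Fin n × Fin 3 × Equiv.Perm (Fin 2),
        ((((Equiv.Perm.sign t.2.2 : ℤˣ) : ℤ) * (-1) ^ (t.2.1 : ℕ) : ℝ) * f t.1) *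
          B (w t.1 (t.2.1.succAbove (t.2.2 0))) (w t.1 (t.2.1.succAbove (t.2.2 1))) := by
  have h := sum_faceIndex_eq (M := ℝ) n f
    (fun c i π => B (w c (i.succAbove (π 0))) (w c (i.succAbove (π 1))))
  simp only [smul_eq_mul] at h
  rw [h, Finset.mul_sum]
  refine Finset.sum_congr rfl fun c _ => ?_
  rw [sum_sign_bilin_faces B hB (w c)]
  ring

/-- The `(k₀, k₁)`-wedge of two vectors of `ℝ^g`, as a bilinear form. [folklore] -/
theorem exists_wedgeForm (k₀ k₁ : Fin g) :
    ∃ B : LinearMap.BilinForm ℝ (Fin g → ℝ),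
      (∀ a b, B a b = a k₀ * b k₁ - a k₁ * b k₀) ∧ ∀ a b, B a b = -B b a := by
  refine ⟨LinearMap.mk₂ ℝ (fun a b : Fin g → ℝ => a k₀ * b k₁ - a k₁ * b k₀) ?_ ?_ ?_ ?_,
    fun a b => rfl, fun a b => ?_⟩
  · intro a a' b; simp only [Pi.add_apply]; ring
  · intro s a b; simp only [Pi.smul_apply, smul_eq_mul]; ring
  · intro a b b'; simp only [Pi.add_apply]; ring
  · intro s a b; simp only [Pi.smul_apply, smul_eq_mul]; ring
  · simp only [LinearMap.mk₂_apply]; ring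

end Transfer

section Main

variable {g : ℕ}

open Classical in
/-- **The cycle condition, read through `Q = P⁻¹`**: for every face index `t₀` of a `P`-cycle `Z`
and every `J`, the signed `J`-framings of the face indices whose `Q`-transformed ordered face is a
`ℤ^g`-translate of that of `t₀` sum to zero (`IsCycle` at `τ = face t₀`, `boundaryCoeff_eq_sum_filter`,
`isTranslate_iff_exists_int`). [cite: Zharkov2020TropicalWeil, p. 2] -/
theorem sum_filter_faceIndex_eq_zero {P Q : Matrix (Fin g) (Fin g) ℝ} (hQP : Q * P = 1)
    (hPQ : P * Q = 1) (Z : Chain ℝ g 2) (hZ : Z.IsCycle P) (J : Sub g 2)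
    (t₀ : Fin Z.size × Fin 3 × Equiv.Perm (Fin 2)) :
    ∑ t ∈ Finset.univ.filter (fun t : Fin Z.size × Fin 3 × Equiv.Perm (Fin 2) => ∃ k : Fin g → ℤ,
        Q.mulVec ((Z.cell t.1).vertex (t.2.1.succAbove (t.2.2 0))) =
            Q.mulVec ((Z.cell t₀.1).vertex (t₀.2.1.succAbove (t₀.2.2 0))) + (fun r => (k r : ℝ)) ∧
          Q.mulVec ((Z.cell t.1).vertex (t.2.1.succAbove (t.2.2 1))) =
            Q.mulVec ((Z.cell t₀.1).vertex (t₀.2.1.succAbove (t₀.2.2 1))) + (fun r => (k r : ℝ))),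
      (((Equiv.Perm.sign t.2.2 : ℤˣ) : ℤ) * (-1) ^ (t.2.1 : ℕ) : ℝ) * ((Z.cell t.1).framing J : ℝ) =
      0 := by
  have h := hZ ((Z.cell t₀.1).face t₀.2.1 ∘ t₀.2.2)
  rw [boundaryCoeff_eq_sum_filter] at h
  have hJ := congr_fun h J
  rw [Finset.sum_apply, Pi.zero_apply] at hJ
  simp only [Pi.smul_apply, smul_eq_mul] at hJ
  have hR := congrArg (fun q : ℚ => (q : ℝ)) hJ
  simp only [Rat.cast_sum, Rat.cast_mul, Rat.cast_intCast, Rat.cast_zero] at hR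
  rw [← hR]
  refine Finset.sum_congr (Finset.filter_congr fun t _ => ?_) fun t _ => by push_cast; ring
  rw [isTranslate_iff_exists_int hQP hPQ]
  rfl

/-- **Start-vertex cancellation for the chain**: against any test function of the (transformed)
first vertex of the ordered faces, the signed framings of a framed `2`-chain sum to zero.
[folklore] -/
theorem sum_faceIndex_startVertex_eq_zero (Q : Matrix (Fin g) (Fin g) ℝ) (Z : Chain ℝ g 2)
    (J : Sub g 2) (F : (Fin g → ℝ) → ℝ) :
    ∑ t : Fin Z.size × Fin 3 × Equiv.Perm (Fin 2),
      (((Equiv.Perm.sign t.2.2 : ℤˣ) : ℤ) * (-1) ^ (t.2.1 : ℕ) : ℝ) * ((Z.cell t.1).framing J : ℝ) *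
        F (Q.mulVec ((Z.cell t.1).vertex (t.2.1.succAbove (t.2.2 0)))) = 0 := by
  have h := sum_faceIndex_eq (M := ℝ) Z.size (fun c => ((Z.cell c).framing J : ℝ))
    (fun c i π => F (Q.mulVec ((Z.cell c).vertex (i.succAbove (π 0)))))
  simp only [smul_eq_mul] at h
  rw [h]
  refine Finset.sum_eq_zero fun c _ => ?_
  have h0 := sum_sign_startVertex_eq_zero (M := ℝ) (fun j => (Z.cell c).vertex j)
    (fun v => F (Q.mulVec v))
  simp only [smul_eq_mul] at h0
  rw [h0, mul_zero]

/-- The involution `(c, i, π) ↦ (c, i, π ∘ swap)` of the face indices (it reverses every ordered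
face and flips its sign). [folklore] -/
theorem exists_faceIndex_involution (n : ℕ) :
    ∃ bar : (Fin n × Fin 3 × Equiv.Perm (Fin 2)) ≃ (Fin n × Fin 3 × Equiv.Perm (Fin 2)),
      ∀ t, (bar t).1 = t.1 ∧ (bar t).2.1 = t.2.1 ∧ (bar t).2.2 = t.2.2 * Equiv.swap 0 1 :=
  ⟨Equiv.prodCongr (Equiv.refl _) (Equiv.prodCongr (Equiv.refl _)
    (Equiv.mulRight (Equiv.swap (0 : Fin 2) 1))), fun _ => ⟨rfl, rfl, rfl⟩⟩

/-- **Period classes of tropical cycles are rational** (general `g`). For a positive definite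
period matrix `P` and a framed simplicial `2`-chain `Z` of `ℝ^g` with vanishing alternating
boundary modulo `P ℤ^g`, the period coordinates `compound 2 P⁻¹ · Z.classOf` are rational.
Proof: by the entry formula (Cauchy–Binet) the `(K, J)` entry is `¼ Σ_t μ_t B(x_t, y_t)` over the
face pairs of `Z` read through `P⁻¹` (`B` the `K`-wedge, `μ_t` the signed `J`-framings); by the
discrete Stokes identity (cycle condition + start-vertex cancellation + face reversal) every vertex
may be replaced by its integer part, which yields `½ Σ_c framing_c(J) · (integer)`.
[cite: MikhalkinZharkov2014Eigenwave, Prop. 4.3 and Thm. 5.4] [cite: Zharkov2020TropicalWeil, p. 2] -/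
theorem cycleClassRational (P : Matrix (Fin g) (Fin g) ℝ) (hP : P.PosDef) (Z : Chain ℝ g 2)
    (hZ : Z.IsCycle P) :
    ∃ M : Matrix (Sub g 2) (Sub g 2) ℚ, compound 2 P⁻¹ * Z.classOf = M.map (algebraMap ℚ ℝ) := by
  classical
  have hdet : IsUnit P.det := isUnit_iff_ne_zero.2 hP.det_pos.ne'
  have hQP : P⁻¹ * P = 1 := Matrix.nonsing_inv_mul P hdet
  have hPQ : P * P⁻¹ = 1 := Matrix.mul_nonsing_inv P hdet
  obtain ⟨rep, ℓ, hdec, hrep, -⟩ := exists_rep_intPart g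
  obtain ⟨bar, hbar⟩ := exists_faceIndex_involution Z.size
  -- the integer vertices `L c j = ℓ (P⁻¹ v_c(j))`
  refine ⟨fun K J => ∑ c, (1 / 2 : ℚ) * (Z.cell c).framing J *
      (((ℓ (P⁻¹.mulVec ((Z.cell c).vertex 1)) - ℓ (P⁻¹.mulVec ((Z.cell c).vertex 0)))
            (K.1.orderEmbOfFin K.2 0) *
          (ℓ (P⁻¹.mulVec ((Z.cell c).vertex 2)) - ℓ (P⁻¹.mulVec ((Z.cell c).vertex 0)))
            (K.1.orderEmbOfFin K.2 1) -
        (ℓ (P⁻¹.mulVec ((Z.cell c).vertex 1)) - ℓ (P⁻¹.mulVec ((Z.cell c).vertex 0)))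
            (K.1.orderEmbOfFin K.2 1) *
          (ℓ (P⁻¹.mulVec ((Z.cell c).vertex 2)) - ℓ (P⁻¹.mulVec ((Z.cell c).vertex 0)))
            (K.1.orderEmbOfFin K.2 0) : ℤ) : ℚ), ?_⟩
  ext K J
  obtain ⟨B, hBapply, hBanti⟩ := exists_wedgeForm (g := g) (K.1.orderEmbOfFin K.2 0)
    (K.1.orderEmbOfFin K.2 1)
  -- the discrete Stokes identity for the ordered faces of `Z` read through `P⁻¹`
  have key := sum_bilin_eq_sum_bilin_intPart
    (fun t : Fin Z.size × Fin 3 × Equiv.Perm (Fin 2) =>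
      P⁻¹.mulVec ((Z.cell t.1).vertex (t.2.1.succAbove (t.2.2 0))))
    (fun t => P⁻¹.mulVec ((Z.cell t.1).vertex (t.2.1.succAbove (t.2.2 1))))
    (fun t => (((Equiv.Perm.sign t.2.2 : ℤˣ) : ℤ) * (-1) ^ (t.2.1 : ℕ) : ℝ) *
      ((Z.cell t.1).framing J : ℝ))
    B hBanti bar
    (fun t => by
      rw [(hbar t).1, (hbar t).2.1, (hbar t).2.2, Equiv.Perm.mul_apply, Equiv.swap_apply_left])
    (fun t => by
      rw [(hbar t).1, (hbar t).2.1, (hbar t).2.2, Equiv.Perm.mul_apply, Equiv.swap_apply_right])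
    (fun t => by
      rw [(hbar t).1, (hbar t).2.1, (hbar t).2.2, Equiv.Perm.sign_mul,
        Equiv.Perm.sign_swap (by decide), Units.val_mul, Units.val_neg, Units.val_one]
      push_cast
      ring)
    (sum_filter_faceIndex_eq_zero hQP hPQ Z hZ J)
    (fun F => sum_faceIndex_startVertex_eq_zero P⁻¹ Z J F)
    rep (fun v r => (ℓ v r : ℝ)) hdec hrep
  -- the entry is `¼ Σ_t μ_t B(x_t, y_t)`
  have lhs := half_sum_bilin_eq_quarter_sum_faces B hBanti Z.size
    (fun c => ((Z.cell c).framing J : ℝ)) (fun c j => P⁻¹.mulVec ((Z.cell c).vertex j))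
  -- the candidate rational is `¼ Σ_t μ_t B(ℓ x_t, ℓ y_t)`
  have rhs := half_sum_bilin_eq_quarter_sum_faces B hBanti Z.size
    (fun c => ((Z.cell c).framing J : ℝ)) (fun c j r => (ℓ (P⁻¹.mulVec ((Z.cell c).vertex j)) r : ℝ))
  rw [Matrix.map_apply, eq_ratCast, compound_mul_classOf_apply]
  simp only [Matrix.mulVec_sub] at lhs ⊢
  simp only [← hBapply]
  rw [lhs, key, ← rhs]
  push_cast
  refine Finset.sum_congr rfl fun c _ => ?_
  rw [hBapply]
  simp only [Pi.sub_apply, Int.cast_sub]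

end Main

/-- **Registered stub `stub_cycleClassRational` of the line `birth`** (crux `FormalCycleCriterion`,
stmt-HodgeConjecture-18571), verbatim: for a positive definite `8 × 8` period matrix `P` and a framed
simplicial `2`-chain `Z` of `ℝ⁸` with `Z.IsCycle P`, the period class `compound 2 P⁻¹ · Z.classOf`
is a rational matrix. The case `g = 8` of `cycleClassRational`.
[cite: MikhalkinZharkov2014Eigenwave, Prop. 4.3 and Thm. 5.4] [cite: Zharkov2020TropicalWeil, p. 2] -/
theorem stub_cycleClassRational :
    ∀ P : Matrix (Fin 8) (Fin 8) ℝ, P.PosDef → ∀ Z : TropicalTorus.Chain ℝ 8 2, Z.IsCycle P →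
      ∃ M : Matrix (TropicalTorus.Sub 8 2) (TropicalTorus.Sub 8 2) ℚ,
        TropicalTorus.compound 2 P⁻¹ * Z.classOf = M.map (algebraMap ℚ ℝ) :=
  fun P hP Z hZ => cycleClassRational P hP Z hZ

end Summit.HodgeConjecture.HodgeConjecture.Theorems.FormalCycleCriterion

end
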